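import Mathlib.RingTheory.Localization.LocalizationLocalization
import Mathlib.RingTheory.Localization.AtPrime.Basic
import Mathlib.RingTheory.Localization.Away.Basic
import Mathlib.RingTheory.Localization.Ideal
import HarnessLib

/-!
# Off the exceptional divisor the blow-up chart has the local rings of the base

Support file for crux stmt-ResolutionOfSingularities-15315
(`FrobeniusLadder.FInjectiveMacaulayfication`, line `Sketch`, lead seat c4, cycle 5, wave 1): stub
`stub_offExceptionalIso` of the §6 BLOW-UP GLUE (E6) package.

Geometric meaning: `R` a ring, `I` an ideal, `a ∈ I`, `A = R[I/a]` the chart ring of the blow-up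
`Bl_I(Spec R)` at `a` with structure map `φ : R → A`, and `S = R[1/a] = A[1/φ a]` compatibly (the
blowing up is an isomorphism away from the centre). At a prime `Q` of the chart NOT on the
exceptional divisor (`φ a ∉ Q`) the local ring `A_Q` of the blow-up is the local ring `R_P` of the
base at `P = φ⁻¹ Q`.

What is proved (abstractly, for any `R`, `A`, `S` carrying the two `IsLocalization.Away` structures
and the compatibility `(algebraMap A S) ∘ φ = algebraMap R S`):

* `isPrime_map_and_comap_map_of_notMem` — if `S = A[1/b]` and `b ∉ Q`, `Q` prime, then `Q·S` is a
  prime of `S` contracting to `Q` (`Q` is disjoint from the powers of `b`;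
  `IsLocalization.isPrime_of_isPrime_disjoint`, `IsLocalization.under_map_of_isPrime_disjoint`).
* `stub_offExceptionalIso` — `A_Q ≃+* R_{φ⁻¹ Q}`. Proof: `Q' = Q·S` is a prime of `S` contracting
  to `Q` in `A`, hence to `φ⁻¹ Q` in `R`. The local ring `T = S_{Q'}` is then simultaneously the
  localization of `A` at `Q` and of `R` at `φ⁻¹ Q` (localization of a localization,
  `IsLocalization.isLocalization_isLocalization_atPrime_isLocalization`, applied over `A` and over
  `R`), and two localizations at the same prime are isomorphic (`IsLocalization.algEquiv`).

References: Stacks Project Tag 02OS ("the blowing up is an isomorphism away from the centre");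
folklore.
-/

-- single-problem summit: the doubled namespace component is forced
set_option linter.dupNamespace false

namespace Summit.ResolutionOfSingularities.ResolutionOfSingularities.Theorems.FInjectiveMacaulayfication.OffExceptionalIso

/-- **Extension of a prime off `V(b)` to `A[1/b]`.** If `S = A[1/b]` and `Q` is a prime of `A`
with `b ∉ Q`, then `Q·S` is a prime of `S` whose contraction to `A` is `Q`. [folklore] -/
theorem isPrime_map_and_comap_map_of_notMem {A : Type} (S : Type) [CommRing A] [CommRing S]
    [Algebra A S] (b : A) [IsLocalization.Away b S] (Q : Ideal A) [Q.IsPrime] (hb : b ∉ Q) :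
    (Q.map (algebraMap A S)).IsPrime ∧ (Q.map (algebraMap A S)).comap (algebraMap A S) = Q := by
  have hdisj : Disjoint (Submonoid.powers b : Set A) ↑Q :=
    (Ideal.disjoint_powers_iff_notMem_of_isPrime b).mpr hb
  exact ⟨IsLocalization.isPrime_of_isPrime_disjoint (Submonoid.powers b) S Q ‹_› hdisj,
    IsLocalization.under_map_of_isPrime_disjoint (Submonoid.powers b) S ‹Q.IsPrime› hdisj⟩

/-- OFF THE EXCEPTIONAL DIVISOR: if `S = R[1/a] = A[1/φ a]` compatibly
(`(algebraMap A S) ∘ φ = algebraMap R S`; e.g. `A = R[I/a]` a blow-up chart), then for a prime `Q`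
of `A` not containing `φ a` the local rings agree: `A_Q ≃+* R_{φ⁻¹ Q}`. Both are the localization
`S_{Q S}` of `S` at the prime `Q S`
(`IsLocalization.isLocalization_isLocalization_atPrime_isLocalization` over `A` and over `R`, then
`IsLocalization.algEquiv`). [cite: StacksProject, Tag 02OS] [folklore] -/
theorem stub_offExceptionalIso : ∀ (R A S : Type) [CommRing R] [CommRing A] [CommRing S] [Algebra R S] [Algebra A S]
    (φ : R →+* A) (a : R), (algebraMap A S).comp φ = algebraMap R S → IsLocalization.Away a S →
    IsLocalization.Away (φ a) S → ∀ (Q : Ideal A) [Q.IsPrime], φ a ∉ Q →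
      Nonempty (Localization.AtPrime Q ≃+* Localization.AtPrime (Q.comap φ)) := by
  intro R A S _ _ _ _ _ φ a hφ _ _ Q _ hQ
  -- `Q' = Q·S` is a prime of `S` contracting to `Q` in `A` and to `φ⁻¹ Q` in `R`
  obtain ⟨hQ', hcomapA⟩ := isPrime_map_and_comap_map_of_notMem S (φ a) Q hQ
  set Q' : Ideal S := Q.map (algebraMap A S)
  have hcomapR : Q'.comap (algebraMap R S) = Q.comap φ := by
    rw [← hφ, ← Ideal.comap_comap, hcomapA]
  -- `T = S_{Q'}` is the localization of `A` at `Q` and of `R` at `φ⁻¹ Q`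
  have hTA : IsLocalization.AtPrime (Localization.AtPrime Q') (Q'.comap (algebraMap A S)) :=
    IsLocalization.isLocalization_isLocalization_atPrime_isLocalization (Submonoid.powers (φ a))
      (Localization.AtPrime Q') Q'
  have hTR : IsLocalization.AtPrime (Localization.AtPrime Q') (Q'.comap (algebraMap R S)) :=
    IsLocalization.isLocalization_isLocalization_atPrime_isLocalization (Submonoid.powers a)
      (Localization.AtPrime Q') Q'
  haveI hTQ : IsLocalization.AtPrime (Localization.AtPrime Q') Q := by
    convert hTA using 2; exact hcomapA.symm
  haveI hTP : IsLocalization.AtPrime (Localization.AtPrime Q') (Q.comap φ) := by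
    convert hTR using 2; exact hcomapR.symm
  -- two localizations of `A` at `Q` (resp. of `R` at `φ⁻¹ Q`) are isomorphic
  exact ⟨(IsLocalization.algEquiv Q.primeCompl (Localization.AtPrime Q)
      (Localization.AtPrime Q')).toRingEquiv.trans
    (IsLocalization.algEquiv (Q.comap φ).primeCompl (Localization.AtPrime (Q.comap φ))
      (Localization.AtPrime Q')).toRingEquiv.symm⟩

end Summit.ResolutionOfSingularities.ResolutionOfSingularities.Theorems.FInjectiveMacaulayfication.OffExceptionalIso
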